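import Summits.HodgeConjecture.CorCM.MumfordTateRankSixConverse
import Summits.HodgeConjecture.CorCM.MumfordTateRankSixNondegenerate
import HarnessLib

/-!
# The rungs `dim MT(H¹(X)) ≤ 6`, X: the class «not of CM type, `dim MT(H¹X) ≤ 6`» as an iff, and the explicit-shape form
# of the nondegeneracy theorem

COR-CM (cell `pub-hodgecm2`, seat `b27` gen 38, count-neutral lane MT-RANK-SIX-CMPART; theorems only, no definition,
no named fact; UNCONDITIONAL — nothing here uses or asserts HC_CM).  Summary file of the lane: `CorCM/MumfordTateRankSixCMRank`
(forward: `X ∼ B^{m+1} × Z`, `dim MT(H¹Z) = dim MT(H¹X) − 3`), `CorCM/MumfordTateRankSixConverse` (backward: the bound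
`dim Lie Hg(H¹X) ≤ dim Lie Hg(H¹B) + dim Lie Hg(H¹Z)`) and `CorCM/MumfordTateRankSixNondegenerate` (`B = D` on all powers).

* **`not_isOfCMType_and_mtRank_le_six_iff`** — for a complex abelian variety `X` with `0 < dim X`: `X` is NOT of CM type
  with `dim MT(H¹X) ≤ 6` IFF `X ∼ B^{m+1} × Z` with `B` SIMPLE, not of CM type, `0 < dim B ≤ 2`, `dim_ℚ End⁰(B) = (dim B)²`
  (a non-CM elliptic curve or a QM abelian surface: Hodge group `SL₂`) and `Z` of CM type which is EITHER zero-dimensional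
  OR has `dim MT(H¹Z) ≤ 3` (i.e. `Z ∼ E^{a}`, `S^{b}`, `E₁^{a} × E₂^{b}` by the CM rungs `2, 3`).
* **`isStablyNondegenerate_of_isIsogenous_powSucc_prod_of_mtRank_le_three`** — explicit-shape form: every
  `X ∼ B^{m+1} × Z` as above is stably nondegenerate; HC for all its powers (`hodgeConjectureFor_powSucc_of_isIsogenous_…`).

## References

* [MoonenZarhin1999LowDim] B. Moonen, Yu. Zarhin, *Hodge classes on abelian varieties of low dimension*, Math. Ann.
  315 (1999), §2 (2.1)–(2.5), condition (D), §3 Thm. (3.2)(2).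
* [Gordon1999HodgeAVSurvey] B. B. Gordon, *A survey of the Hodge conjecture for abelian varieties* (1999), Thm. 7.5,
  Def. 7.6, §7.3.2.
* [MumfordAV1970] D. Mumford, *Abelian Varieties* (1970), §1 (3) and §19 Thm. 1, Cor. 1–2.
-/

noncomputable section

open CategoryTheory CategoryTheory.Limits Module

namespace Summit.HodgeConjecture.CorCM

open Literature.AlgebraicGeometry.Motives
open Literature.AlgebraicGeometry.Motives.AbelianVariety
open Literature.AlgebraicGeometry.Motives.HodgeStructure
open Literature.AlgebraicGeometry.HodgeTheory
open Literature.AlgebraicGeometry.Milne1999 (IsOfCMType)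

variable [HodgeTensorFacts.{0, 0}] {X : AbelianVariety ℂ} {n : ℕ}

/-- **A zero-dimensional abelian variety has `Lie Hg(H¹Z) = 0`** (`dim_ℚ H¹(Z) = 2 dim Z = 0`, so `End_ℚ(H¹Z) = 0`).
[cite: MumfordAV1970, §1 (3)] -/
theorem finrank_hodgeLie_hodge_one_eq_zero_of_dim_eq_zero {Z : AbelianVariety ℂ} (hZ : IsSmoothProjective Z.dim Z.X)
    (h0 : Z.dim = 0) :
    haveI := BettiUniverse.finite hZ 1
    Module.finrank ℚ (BettiUniverse.hodge exists_isReal_hodgeModel_holds hZ 1).hodgeLie = 0 := by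
  haveI := BettiUniverse.finite hZ 1
  have hV : Module.finrank ℚ (bettiCohomology Z.X 1) = 0 := by rw [finrank_bettiCohomology_one, h0, mul_zero]
  have hE : Module.finrank ℚ (Module.End ℚ (bettiCohomology Z.X 1)) = 0 := by
    rw [Module.finrank_linearMap, hV, mul_zero]
  have h := Submodule.finrank_le (BettiUniverse.hodge exists_isReal_hodgeModel_holds hZ 1).hodgeLie
  omega

/-- **The class «NOT of CM type, `dim MT(H¹(X)) ≤ 6`» as an iff.**  For a complex abelian variety `X` with `0 < dim X`:
`X` is not of CM type with `dim MT(H¹X) ≤ 6` IFF `X ∼ B^{m+1} × Z` with `B` SIMPLE, NOT of CM type, `0 < dim B ≤ 2`,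
`dim_ℚ End⁰(B) = (dim B)²` (a non-CM elliptic curve or a QM abelian surface) and `Z` of CM type with `dim Z = 0` or
`dim MT(H¹Z) ≤ 3` (`Z ∼ E^a`, `S^b` or `E₁^a × E₂^b`).  `⟹`: `CorCM/MumfordTateRankSixCMRank`; `⟸`:
`CorCM/MumfordTateRankSixConverse` §2 (and `Lie Hg(H¹Z) = 0` for `dim Z = 0`).
[cite: MoonenZarhin1999LowDim, §2 (2.1)–(2.5)] [cite: MumfordAV1970, §19 Thm. 1, Cor. 1–2] -/
theorem not_isOfCMType_and_mtRank_le_six_iff (hX : IsSmoothProjective n X.X) (h0 : 0 < X.dim) :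
    haveI := BettiUniverse.finite hX 1
    (¬ IsOfCMType X ∧ (BettiUniverse.hodge exists_isReal_hodgeModel_holds hX 1).mtRank ≤ 6) ↔
      ∃ (B Z : AbelianVariety ℂ) (m : ℕ), B.IsSimple ∧ 0 < B.dim ∧ B.dim ≤ 2 ∧ ¬ IsOfCMType B ∧
        Module.finrank ℚ B.endAlgebra = B.dim ^ 2 ∧ IsOfCMType Z ∧ IsIsogenous X ((B.powSucc m).prod Z) ∧
        (Z.dim = 0 ∨ (0 < Z.dim ∧
          haveI := BettiUniverse.finite (AbelianVariety.isSmoothProjective_holds (A := Z)) 1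
          (BettiUniverse.hodge exists_isReal_hodgeModel_holds (AbelianVariety.isSmoothProjective_holds (A := Z)) 1).mtRank
            ≤ 3)) := by
  haveI := BettiUniverse.finite hX 1
  constructor
  · rintro ⟨hcm, h6⟩
    obtain ⟨B, Z, m, hBs, hB0, hB2, hBcm, hfinB, -, hZcm, hXYZ, -, -, -, -, -, hmt3⟩ :=
      exists_isIsogenous_powSucc_prod_finrank_hodgeLie_of_mtRank_le_six hX h0 hcm h6
    refine ⟨B, Z, m, hBs, hB0, hB2, hBcm, hfinB, hZcm, hXYZ, ?_⟩
    rcases Nat.eq_zero_or_pos Z.dim with hZ0 | hZpos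
    · exact Or.inl hZ0
    · exact Or.inr ⟨hZpos, hmt3 hZpos⟩
  · rintro ⟨B, Z, m, hBs, hB0, hB2, hBcm, hfinB, -, hXYZ, hZ⟩
    rcases hZ with hZ0 | ⟨hZpos, hZ3⟩
    · refine not_isOfCMType_and_mtRank_le_six_of_isIsogenous_powSucc_prod hX h0 hBs hB0 hB2 hBcm hfinB ?_ hXYZ
      have h := finrank_hodgeLie_hodge_one_eq_zero_of_dim_eq_zero (AbelianVariety.isSmoothProjective_holds (A := Z)) hZ0
      omega
    · exact not_isOfCMType_and_mtRank_le_six_of_isIsogenous_powSucc_prod_of_mtRank_le_three hX h0 hBs hB0 hB2 hBcm hfinB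
        hZpos hZ3 hXYZ

/-- **Explicit-shape form of the nondegeneracy theorem.**  `X ∼ B^{m+1} × Z` with `B` a non-CM elliptic curve or a QM surface
(`B` simple, not CM, `0 < dim B ≤ 2`, `dim End⁰B = (dim B)²`) and `Z` of positive dimension with `dim MT(H¹Z) ≤ 3` (then `Z` is
of CM type: `Z ∼ E^a`, `S^b`, `E₁^a × E₂^b`) ⟹ `X` is STABLY NONDEGENERATE (`B = D` on all powers), UNCONDITIONALLY.
[cite: MoonenZarhin1999LowDim, §2 condition (D) and §3 Thm. (3.2)(2)] [cite: Gordon1999HodgeAVSurvey, Thm. 7.5 and Def. 7.6] -/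
theorem isStablyNondegenerate_of_isIsogenous_powSucc_prod_of_mtRank_le_three (hX : IsSmoothProjective n X.X)
    (h0 : 0 < X.dim) {B Z : AbelianVariety ℂ} {m : ℕ} (hBs : B.IsSimple) (hB0 : 0 < B.dim) (hB2 : B.dim ≤ 2)
    (hBcm : ¬ IsOfCMType B) (hfinB : Module.finrank ℚ B.endAlgebra = B.dim ^ 2) (hZ0 : 0 < Z.dim)
    (hZ3 : haveI := BettiUniverse.finite (AbelianVariety.isSmoothProjective_holds (A := Z)) 1
      (BettiUniverse.hodge exists_isReal_hodgeModel_holds (AbelianVariety.isSmoothProjective_holds (A := Z)) 1).mtRank ≤ 3)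
    (hXBZ : IsIsogenous X ((B.powSucc m).prod Z)) : IsStablyNondegenerate X := by
  obtain ⟨hcm, h6⟩ := not_isOfCMType_and_mtRank_le_six_of_isIsogenous_powSucc_prod_of_mtRank_le_three hX h0 hBs hB0
    hB2 hBcm hfinB hZ0 hZ3 hXBZ
  exact isStablyNondegenerate_of_not_isOfCMType_of_mtRank_le_six hX h0 hcm h6

/-- **… hence the Hodge conjecture for every power of such an `X ∼ B^{m+1} × Z`**, UNCONDITIONALLY.
[cite: MoonenZarhin1999LowDim, §2 condition (D) and §3 Thm. (3.2)(2)] [cite: Gordon1999HodgeAVSurvey, §7.3.2] -/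
theorem hodgeConjectureFor_powSucc_of_isIsogenous_powSucc_prod_of_mtRank_le_three (hX : IsSmoothProjective n X.X)
    (h0 : 0 < X.dim) {B Z : AbelianVariety ℂ} {m : ℕ} (hBs : B.IsSimple) (hB0 : 0 < B.dim) (hB2 : B.dim ≤ 2)
    (hBcm : ¬ IsOfCMType B) (hfinB : Module.finrank ℚ B.endAlgebra = B.dim ^ 2) (hZ0 : 0 < Z.dim)
    (hZ3 : haveI := BettiUniverse.finite (AbelianVariety.isSmoothProjective_holds (A := Z)) 1
      (BettiUniverse.hodge exists_isReal_hodgeModel_holds (AbelianVariety.isSmoothProjective_holds (A := Z)) 1).mtRank ≤ 3)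
    (hXBZ : IsIsogenous X ((B.powSucc m).prod Z)) (N : ℕ) :
    HodgeConjectureFor (X.powSucc N).dim (X.powSucc N).X :=
  (isStablyNondegenerate_of_isIsogenous_powSucc_prod_of_mtRank_le_three hX h0 hBs hB0 hB2 hBcm hfinB hZ0 hZ3
    hXBZ).hodgeConjectureFor_powSucc N

end Summit.HodgeConjecture.CorCM

end
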